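import Literature.Barriers.CriticalPhenomena.PlaquetteWalkHoleRootDiagonalCellTurning
import HarnessLib

/-!
# Barrier catalogue (SAWScalingLimit): the THREE-DOOR LAWS at the diagonal cell of a hole root

Companion of `PlaquetteWalkHoleRootDiagonalCellTurning` (the diagonal-cell law `VF_D(w.side W, d) = i·v(θ)·Σ ext·diagDir`
at `d = farSW w`, eight class directions, entry–exit exclusion). When one of the two OUTER doors of `d` is closed — the
face `farSWS w = (w.1 − 2, w.2 − 2)` south of `d` or the face `farSWW w = (w.1 − 3, w.2 − 1)` west of `d` is not in the
domain — only two classes survive and their directions are EXACTLY ANTIPODAL, so the defect lies on one fixed line and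
vanishes iff two masses balance (the shape of the far-cell and lateral-cell laws of this catalogue):

* `ΩG.firstSide_ne_of_faces_farSW`, `ΩG.exit_return_ne_of_faces_farSW` — a closed door is neither a first side
  (the last prefix arc would lie in the missing face) nor an exit/return side (the tree's `ΩG.exit_return_doors`).
* `ΩG.diagDir_of_S_closed` — door `S` closed: a class-`B2a` walk at `d` enters from `N` with class `{E, W}` (direction
  `e^{i(3θ/8 − π/8)}`) or from `E` with class `{N, W}` (direction `−e^{i(3θ/8 − π/8)}`); `W`-entries do not occur
  (their only class `{E, S}` needs the closed door). `ΩG.diagDir_of_W_closed` — door `W` closed: `N`/`{E, S}`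
  (`e^{iπ/8}`) or `E`/`{N, S}` (`−e^{iπ/8}`); no `S`-entries.
* `ΩG.firstMassD` (exterior weight of a wound walk with prescribed first side), `ΩG.diagClassTerm_of_S_closed` /
  `_of_W_closed`.
* ★★★ `PlaquetteWalk.vertexFunctional_printed_farSW_eq_of_S_closed`:
  `VF_D(w.side W, d) = i·v(θ)·e^{i(3θ/8 − π/8)}·(M_N − M_E)`; ★★★ `…_eq_of_W_closed`: `= i·v(θ)·e^{iπ/8}·(M_N − M_E)`
  (`M_N, M_E ≥ 0` the total exterior weights of the wound walks entering from `N` resp. `E`), for every `θ ∈ [π/3, 2π/3]`;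
  ★★ `…_eq_zero_iff_of_S_closed`: `VF(d) = 0 ↔ M_N = M_E`.

References, as printed: A. Glazman, I. Manolescu, arXiv:1708.00395v3, Lemma 2.1 (p. 6, «in the form given in [Gl]»)
[GlazmanManolescu2019]; A. Glazman, Electron. Commun. Probab. 20 (2015) no. 86, Lemma 3.1 and its proof pp. 6–7,
eq. (1) [Glazman2015WeightedSAW]; H. Hopf, Compositio Math. 2 (1935) 50–62, Nr. 2 (p. 53), Nr. 4 eq. (22)
(pp. 60–61) [Hopf1935]. Status: lane corollaries of the diagonal-cell law; not located in print. NOT claimed: the sign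
of `M_N − M_E`; the four-door cell is treated in § DOMINANCE / § PAIRING below. Written for the venture lane «pcv-sawmu» (Tier B, b-step0 gen 19).

§ DOMINANCE (appended): at the four-door cell the two cone groups `N/W` and `E/S` are antipodal up to opening `π/4`;
`Σ(M_E+M_S) < cos(π/8)·Σ(M_N+M_W)` or the mirror inequality forces `VF ≠ 0` (near-balance is necessary for a zero).
§ PAIRING (appended): the eight realizable patterns at the diagonal cell form four ANTIPODAL PAIRS indexed by the free side `z₃`
(`diagDir_pairing`); hence ★★★ `VF = i·v·Σ_{z₃} pairDir(z₃)·(P(z₃) − M(z₃))` (signed sum over the four free sides, directions in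
the arc `[0, π/4]`) and SIGNED DOMINANCE (`P ≥ M` for every free side, strictly once ⇒ `VF ≠ 0`).
-/

noncomputable section

namespace Literature.Probability.RandomPlanarGeometry.SAW.YangBaxter

open Real Complex

section ThreeDoorCells

variable (w : Face)

/-- The face south of the diagonal cell. [cite: GlazmanManolescu2019, §1 (the lattice of rhombi and its mid-edges)] -/
def farSWS : Face := (w.1 - 2, w.2 - 2)

/-- The face west of the diagonal cell. [cite: GlazmanManolescu2019, §1 (the lattice of rhombi and its mid-edges)] -/
def farSWW : Face := (w.1 - 3, w.2 - 1)

/-- The faces of the diagonal cell's door `S`. [cite: GlazmanManolescu2019, §1 (the lattice of rhombi and its mid-edges)] -/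
theorem farSW_side_S_faces : ((farSW w).side .S).faces = (farSWS w, farSW w) := by
  obtain ⟨k, j⟩ := w; simp [farSW, farSWS, Face.side, MidEdge.faces]; omega

/-- The faces of the diagonal cell's door `W`. [cite: GlazmanManolescu2019, §1 (the lattice of rhombi and its mid-edges)] -/
theorem farSW_side_W_faces : ((farSW w).side .W).faces = (farSWW w, farSW w) := by
  obtain ⟨k, j⟩ := w; simp [farSW, farSWW, Face.side, MidEdge.faces]; omega

end ThreeDoorCells

namespace ΩG

variable {D : Set Face} {w : Face} {ω : ΩG D (w.side .W) (farSW w)}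


/-- The root is not a side of the diagonal cell (private twin of CAR 1's helper, which is private there). [folklore] -/
private theorem farSW_side_ne_rootD4 (w : Face) (t : Side) : (farSW w).side t ≠ w.side .W := by
  obtain ⟨k, j⟩ := w
  cases t <;> simp only [farSW, Face.side, ne_eq, MidEdge.vert.injEq, reduceCtorEq, not_false_eq_true] <;> omega
/-- ★ **A closed door is not a first side**: if the face across the side `t` of the diagonal cell is not in the domain,
no class-`B2a` walk first enters the cell through `t` (the last prefix arc would lie in that face).
[cite: Glazman2015WeightedSAW, Lemma 3.1 (proof, pp. 6–7: the classes of walks through a rhombus)] -/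
theorem firstSide_ne_of_faces_farSW (hh : holeFaceW w ∉ D) (h : ω.IsB2a) {t : Side} {g : Face} (hg : g ∉ D)
    (hfaces : ((farSW w).side t).faces = (g, farSW w) ∨ ((farSW w).side t).faces = (farSW w, g)) :
    ω.2.firstSideG ≠ t := by
  intro hz
  obtain ⟨hs, ht⟩ := preD_sOut_last (ω := ω) hh h
  have hpos : 0 < ω.2.firstHitG := by
    by_contra h0
    push Not at h0
    have e := ω.2.nth_firstHitG
    rw [Nat.le_zero.1 h0, ω.2.nth_zero] at e
    exact (farSW_side_ne_rootD4 w _) e.symm |>.elim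
  obtain ⟨hD, hne, -⟩ := preD_fc (ω := ω) hh h (i := ω.2.firstHitG - 1) (by omega)
  rw [hz] at ht
  have hcases := (Face.exists_side_eq_iff _ _).1 ⟨_, ht⟩
  rcases hfaces with hf | hf <;> rw [hf] at hcases <;> rcases hcases with e | e
  · have e' : (ω.preD h).fc (ω.2.firstHitG - 1) = g := e
    rw [e'] at hD; exact hg hD
  · exact hne e
  · exact hne e
  · have e' : (ω.preD h).fc (ω.2.firstHitG - 1) = g := e
    rw [e'] at hD; exact hg hD

/-- ★ **Closed doors are neither exit nor return sides.** [cite: Glazman2015WeightedSAW, Lemma 3.1 (proof, pp. 6–7)] -/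
theorem exit_return_ne_of_faces_farSW (hr : RootedFace D (w.side .W) (farSW w)) (h : ω.IsB2a) {t : Side} {g : Face}
    (hg : g ∉ D) (hfaces : ((farSW w).side t).faces = (g, farSW w) ∨ ((farSW w).side t).faces = (farSW w, g)) :
    ω.z1 hr h ≠ t ∧ ω.1 ≠ t := by
  have hdoors := ω.exit_return_doors hr h
  refine ⟨fun e => ?_, fun e => ?_⟩
  · rw [e] at hdoors
    rcases hfaces with hf | hf <;> rw [hf] at hdoors
    · exact hg hdoors.1.1
    · exact hg hdoors.1.2
  · rw [e] at hdoors
    rcases hfaces with hf | hf <;> rw [hf] at hdoors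
    · exact hg hdoors.2.1
    · exact hg hdoors.2.2

/-- The two classes of the `S`-closed three-door cell, by first side: `N` with `{E, W}` points along
`e^{i(3θ/8 − π/8)}`, `E` with `{N, W}` along `−e^{i(3θ/8 − π/8)}`, and `W` does not occur.
[cite: GlazmanManolescu2019, Lemma 2.1 (statement, "in the form given in [Gl]")] [cite: Glazman2015WeightedSAW, Lemma 3.1, eq. (1) (the weight v(θ))] -/
theorem diagDir_of_S_closed (hh : holeFaceW w ∉ D) (hr : RootedFace D (w.side .W) (farSW w)) (h : ω.IsB2a)
    (hS : farSWS w ∉ D) (θ : ℝ) :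
    (ω.2.firstSideG = .N ∧ diagDir θ ω.2.firstSideG (ω.z1 hr h) ω.1 =
        Complex.exp ((((3 * θ / 8 - π / 8 : ℝ)) : ℂ) * Complex.I)) ∨
      (ω.2.firstSideG = .E ∧ diagDir θ ω.2.firstSideG (ω.z1 hr h) ω.1 =
        -Complex.exp ((((3 * θ / 8 - π / 8 : ℝ)) : ℂ) * Complex.I)) := by
  obtain ⟨hz01, hz02, hz12⟩ := ω.firstSide_exit_return_distinct hr h
  obtain ⟨hexS, hexW⟩ := farSW_entry_exit_exclusion hh hr h
  have h0S := firstSide_ne_of_faces_farSW (ω := ω) hh h hS (Or.inl (farSW_side_S_faces w))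
  obtain ⟨h1S, h2S⟩ := exit_return_ne_of_faces_farSW (ω := ω) hr h hS (Or.inl (farSW_side_S_faces w))
  have hneg : -Complex.exp ((((3 * θ / 8 - π / 8 : ℝ)) : ℂ) * Complex.I) =
      Complex.exp ((((3 * θ / 8 - 9 * π / 8 : ℝ)) : ℂ) * Complex.I) := by
    rw [show (((3 * θ / 8 - 9 * π / 8 : ℝ)) : ℂ) * Complex.I =
        (((3 * θ / 8 - π / 8 : ℝ)) : ℂ) * Complex.I + (-(π : ℂ)) * Complex.I by push_cast; ring, Complex.exp_add,
      show (-(π : ℂ)) * Complex.I = -((π : ℂ) * Complex.I) by ring, Complex.exp_neg, Complex.exp_pi_mul_I]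
    ring
  revert hz01 hz02 hz12 hexS hexW h0S h1S h2S
  rcases ω.2.firstSideG with _ | _ | _ | _ <;> rcases ω.z1 hr h with _ | _ | _ | _ <;> rcases ω.1 with _ | _ | _ | _ <;>
    intro hz01 hz02 hz12 hexS hexW h0S h1S h2S <;>
    first
    | exact absurd rfl hz01
    | exact absurd rfl hz02
    | exact absurd rfl hz12
    | exact absurd rfl h0S
    | exact absurd rfl h1S
    | exact absurd rfl h2S
    | exact absurd rfl (hexS rfl).1
    | exact absurd rfl (hexS rfl).2
    | exact absurd rfl (hexW rfl).1
    | exact absurd rfl (hexW rfl).2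
    | (left; exact ⟨rfl, rfl⟩)
    | (right; exact ⟨rfl, hneg.symm⟩)

/-- The two classes of the `W`-closed three-door cell: `N` with `{E, S}` along `e^{iπ/8}`, `E` with `{N, S}` along
`−e^{iπ/8}`, and `S` does not occur. [cite: GlazmanManolescu2019, Lemma 2.1 (statement, "in the form given in [Gl]")] [cite: Glazman2015WeightedSAW, Lemma 3.1, eq. (1) (the weight v(θ))] -/
theorem diagDir_of_W_closed (hh : holeFaceW w ∉ D) (hr : RootedFace D (w.side .W) (farSW w)) (h : ω.IsB2a)
    (hWc : farSWW w ∉ D) (θ : ℝ) :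
    (ω.2.firstSideG = .N ∧ diagDir θ ω.2.firstSideG (ω.z1 hr h) ω.1 = Complex.exp ((((π / 8 : ℝ)) : ℂ) * Complex.I)) ∨
      (ω.2.firstSideG = .E ∧ diagDir θ ω.2.firstSideG (ω.z1 hr h) ω.1 =
        -Complex.exp ((((π / 8 : ℝ)) : ℂ) * Complex.I)) := by
  obtain ⟨hz01, hz02, hz12⟩ := ω.firstSide_exit_return_distinct hr h
  obtain ⟨hexS, hexW⟩ := farSW_entry_exit_exclusion hh hr h
  have h0W := firstSide_ne_of_faces_farSW (ω := ω) hh h hWc (Or.inl (farSW_side_W_faces w))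
  obtain ⟨h1W, h2W⟩ := exit_return_ne_of_faces_farSW (ω := ω) hr h hWc (Or.inl (farSW_side_W_faces w))
  have hneg : -Complex.exp ((((π / 8 : ℝ)) : ℂ) * Complex.I) = Complex.exp ((((-(7 * π / 8) : ℝ)) : ℂ) * Complex.I) := by
    rw [show (((-(7 * π / 8) : ℝ)) : ℂ) * Complex.I = (((π / 8 : ℝ)) : ℂ) * Complex.I + (-(π : ℂ)) * Complex.I by
        push_cast; ring, Complex.exp_add, show (-(π : ℂ)) * Complex.I = -((π : ℂ) * Complex.I) by ring, Complex.exp_neg,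
      Complex.exp_pi_mul_I]
    ring
  revert hz01 hz02 hz12 hexS hexW h0W h1W h2W
  rcases ω.2.firstSideG with _ | _ | _ | _ <;> rcases ω.z1 hr h with _ | _ | _ | _ <;> rcases ω.1 with _ | _ | _ | _ <;>
    intro hz01 hz02 hz12 hexS hexW h0W h1W h2W <;>
    first
    | exact absurd rfl hz01
    | exact absurd rfl hz02
    | exact absurd rfl hz12
    | exact absurd rfl h0W
    | exact absurd rfl h1W
    | exact absurd rfl h2W
    | exact absurd rfl (hexS rfl).1
    | exact absurd rfl (hexS rfl).2
    | exact absurd rfl (hexW rfl).1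
    | exact absurd rfl (hexW rfl).2
    | (left; exact ⟨rfl, rfl⟩)
    | (right; exact ⟨rfl, hneg.symm⟩)

open Classical in
/-- **The first-side mass** at the diagonal cell: the exterior weight of a WOUND class-`B2a` walk whose first side is
`s`, else `0`. [cite: GlazmanManolescu2019, Lemma 2.1 (statement, "in the form given in [Gl]")] [cite: Glazman2015WeightedSAW, Lemma 3.1 (proof, pp. 6–7)] -/
noncomputable def firstMassD (θ : ℝ) (hr : RootedFace D (w.side .W) (farSW w)) (s : Side)
    (ω : ΩG D (w.side .W) (farSW w)) : ℝ :=
  if h : ω.IsB2a then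
    (if ω.2.firstSideG = s ∧ ω.WE (fun _ => θ) ≠ excursionWinding θ ω.2.firstSideG (ω.z1 hr h) ω.1 then
      ω.2.extWeight (fun _ => θ) (farSW w) else 0)
  else 0

/-- First-side masses are non-negative on `[π/3, 2π/3]`. [cite: GlazmanManolescu2019, eq. (1) (the weights are non-negative)] -/
theorem firstMassD_nonneg {θ : ℝ} (hθ : θ ∈ Set.Icc (π / 3) (2 * π / 3)) (hr : RootedFace D (w.side .W) (farSW w))
    (s : Side) (ω : ΩG D (w.side .W) (farSW w)) : 0 ≤ firstMassD θ hr s ω := by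
  unfold firstMassD
  split_ifs
  · exact Finset.prod_nonneg fun _ _ => localWeight_nonneg hθ _
  · exact le_rfl
  · exact le_rfl

/-- ★★ **The diagonal class term when the door `S` is closed**: `diagClassTerm = e^{i(3θ/8 − π/8)}·(firstMass_N − firstMass_E)`.
[cite: GlazmanManolescu2019, Lemma 2.1 (statement, "in the form given in [Gl]")] [cite: Glazman2015WeightedSAW, Lemma 3.1 (proof, pp. 6–7)] -/
theorem diagClassTerm_of_S_closed (hh : holeFaceW w ∉ D) (hr : RootedFace D (w.side .W) (farSW w))
    (hS : farSWS w ∉ D) (θ : ℝ) (ω : ΩG D (w.side .W) (farSW w)) (h : ω.IsB2a) :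
    diagClassTerm θ hr ω = Complex.exp ((((3 * θ / 8 - π / 8 : ℝ)) : ℂ) * Complex.I) *
      ((firstMassD θ hr .N ω - firstMassD θ hr .E ω : ℝ) : ℂ) := by
  unfold diagClassTerm firstMassD
  rw [dif_pos h, dif_pos h, dif_pos h]
  by_cases hw : ω.WE (fun _ => θ) ≠ excursionWinding θ ω.2.firstSideG (ω.z1 hr h) ω.1
  · rw [if_pos hw]
    rcases diagDir_of_S_closed (ω := ω) hh hr h hS θ with ⟨hz, hd⟩ | ⟨hz, hd⟩
    · rw [hd, if_pos ⟨hz, hw⟩, if_neg (fun H => by rw [hz] at H; exact absurd H.1 (by decide))]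
      push_cast; ring
    · rw [hd, if_neg (fun H => by rw [hz] at H; exact absurd H.1 (by decide)), if_pos ⟨hz, hw⟩]
      push_cast; ring
  · rw [if_neg hw, if_neg (fun H => hw H.2), if_neg (fun H => hw H.2)]
    push_cast; ring

/-- ★★ **The diagonal class term when the door `W` is closed**: `diagClassTerm = e^{iπ/8}·(firstMass_N − firstMass_E)`.
[cite: GlazmanManolescu2019, Lemma 2.1 (statement, "in the form given in [Gl]")] [cite: Glazman2015WeightedSAW, Lemma 3.1 (proof, pp. 6–7)] -/
theorem diagClassTerm_of_W_closed (hh : holeFaceW w ∉ D) (hr : RootedFace D (w.side .W) (farSW w))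
    (hWc : farSWW w ∉ D) (θ : ℝ) (ω : ΩG D (w.side .W) (farSW w)) (h : ω.IsB2a) :
    diagClassTerm θ hr ω = Complex.exp ((((π / 8 : ℝ)) : ℂ) * Complex.I) *
      ((firstMassD θ hr .N ω - firstMassD θ hr .E ω : ℝ) : ℂ) := by
  unfold diagClassTerm firstMassD
  rw [dif_pos h, dif_pos h, dif_pos h]
  by_cases hw : ω.WE (fun _ => θ) ≠ excursionWinding θ ω.2.firstSideG (ω.z1 hr h) ω.1
  · rw [if_pos hw]
    rcases diagDir_of_W_closed (ω := ω) hh hr h hWc θ with ⟨hz, hd⟩ | ⟨hz, hd⟩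
    · rw [hd, if_pos ⟨hz, hw⟩, if_neg (fun H => by rw [hz] at H; exact absurd H.1 (by decide))]
      push_cast; ring
    · rw [hd, if_neg (fun H => by rw [hz] at H; exact absurd H.1 (by decide)), if_pos ⟨hz, hw⟩]
      push_cast; ring
  · rw [if_neg hw, if_neg (fun H => hw H.2), if_neg (fun H => hw H.2)]
    push_cast; ring

end ΩG

end Literature.Probability.RandomPlanarGeometry.SAW.YangBaxter

namespace Literature.Barriers.CriticalPhenomena.PlaquetteWalk

open Literature.Probability.RandomPlanarGeometry.SAW.YangBaxter
open Real Complex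

/-- ★★★ **THE THREE-DOOR DIAGONAL LAW, door `S` closed.** If the face south of the diagonal cell `d = farSW w` is not in
the domain (so `d` has the three doors `N`, `E`, `W`), then for every `θ ∈ [π/3, 2π/3]` the vertex functional of the
hole root at `d` lies on ONE FIXED LINE: `VF_D(w.side W, d) = i·v(θ)·e^{i(3θ/8 − π/8)}·(M_N − M_E)`, where `M_N`, `M_E ≥ 0`
are the total exterior weights of the wound class-`B2a` walks entering from `N` (class `{E, W}`) resp. from `E` (class
`{N, W}`) — the two surviving directions are exactly antipodal, and no walk enters from `W`.
[cite: GlazmanManolescu2019, Lemma 2.1 (statement, "in the form given in [Gl]")] [cite: Glazman2015WeightedSAW, Lemma 3.1 (proof, pp. 6–7)]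
[cite: Hopf1935, Nr. 2 (Umlaufsatz, p. 53) and Nr. 4 eq. (22) (curves with corners, pp. 60–61)] -/
theorem vertexFunctional_printed_farSW_eq_of_S_closed {θ : ℝ} (hθ : θ ∈ Set.Icc (π / 3) (2 * π / 3))
    (Dl : List Face) (w : Face) (hf : farSW w ∈ Dl) (hh : holeFaceW w ∉ dom Dl) (hS : farSWS w ∉ dom Dl)
    (hr : RootedFace (dom Dl) (w.side .W) (farSW w)) :
    vertexFunctional (printedWeights θ) tFiveEighths (ybCoeff θ) Dl (w.side .W) (farSW w) =
      Complex.I * (weightV θ : ℂ) * Complex.exp ((((3 * θ / 8 - π / 8 : ℝ)) : ℂ) * Complex.I) *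
        (((∑ ω ∈ ΩG.setB2a (dom Dl) (w.side .W) (farSW w), ΩG.firstMassD θ hr .N ω) -
          ∑ ω ∈ ΩG.setB2a (dom Dl) (w.side .W) (farSW w), ΩG.firstMassD θ hr .E ω : ℝ) : ℂ) := by
  have hsum : ∑ ω ∈ ΩG.setB2a (dom Dl) (w.side .W) (farSW w), ΩG.diagClassTerm θ hr ω =
      Complex.exp ((((3 * θ / 8 - π / 8 : ℝ)) : ℂ) * Complex.I) *
        (((∑ ω ∈ ΩG.setB2a (dom Dl) (w.side .W) (farSW w), ΩG.firstMassD θ hr .N ω) -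
          ∑ ω ∈ ΩG.setB2a (dom Dl) (w.side .W) (farSW w), ΩG.firstMassD θ hr .E ω : ℝ) : ℂ) := by
    push_cast
    rw [← Finset.sum_sub_distrib, Finset.mul_sum]
    refine Finset.sum_congr rfl fun ω hω => ?_
    simp only [ΩG.setB2a, Finset.mem_filter, Finset.mem_univ, true_and] at hω
    rw [ΩG.diagClassTerm_of_S_closed hh hr hS θ ω hω]; push_cast; ring
  rw [vertexFunctional_printed_farSW_eq hθ Dl w hf hh hr, hsum]; ring

/-- ★★★ **THE THREE-DOOR DIAGONAL LAW, door `W` closed**: `VF_D(w.side W, d) = i·v(θ)·e^{iπ/8}·(M_N − M_E)` with the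
classes `N`/`{E, S}` and `E`/`{N, S}`; no walk enters from `S`. [cite: GlazmanManolescu2019, Lemma 2.1 (statement, "in the form given in [Gl]")]
[cite: Glazman2015WeightedSAW, Lemma 3.1 (proof, pp. 6–7)] [cite: Hopf1935, Nr. 2 (Umlaufsatz, p. 53) and Nr. 4 eq. (22) (curves with corners, pp. 60–61)] -/
theorem vertexFunctional_printed_farSW_eq_of_W_closed {θ : ℝ} (hθ : θ ∈ Set.Icc (π / 3) (2 * π / 3))
    (Dl : List Face) (w : Face) (hf : farSW w ∈ Dl) (hh : holeFaceW w ∉ dom Dl) (hWc : farSWW w ∉ dom Dl)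
    (hr : RootedFace (dom Dl) (w.side .W) (farSW w)) :
    vertexFunctional (printedWeights θ) tFiveEighths (ybCoeff θ) Dl (w.side .W) (farSW w) =
      Complex.I * (weightV θ : ℂ) * Complex.exp ((((π / 8 : ℝ)) : ℂ) * Complex.I) *
        (((∑ ω ∈ ΩG.setB2a (dom Dl) (w.side .W) (farSW w), ΩG.firstMassD θ hr .N ω) -
          ∑ ω ∈ ΩG.setB2a (dom Dl) (w.side .W) (farSW w), ΩG.firstMassD θ hr .E ω : ℝ) : ℂ) := by
  have hsum : ∑ ω ∈ ΩG.setB2a (dom Dl) (w.side .W) (farSW w), ΩG.diagClassTerm θ hr ω =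
      Complex.exp ((((π / 8 : ℝ)) : ℂ) * Complex.I) *
        (((∑ ω ∈ ΩG.setB2a (dom Dl) (w.side .W) (farSW w), ΩG.firstMassD θ hr .N ω) -
          ∑ ω ∈ ΩG.setB2a (dom Dl) (w.side .W) (farSW w), ΩG.firstMassD θ hr .E ω : ℝ) : ℂ) := by
    push_cast
    rw [← Finset.sum_sub_distrib, Finset.mul_sum]
    refine Finset.sum_congr rfl fun ω hω => ?_
    simp only [ΩG.setB2a, Finset.mem_filter, Finset.mem_univ, true_and] at hω
    rw [ΩG.diagClassTerm_of_W_closed hh hr hWc θ ω hω]; push_cast; ring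
  rw [vertexFunctional_printed_farSW_eq hθ Dl w hf hh hr, hsum]; ring

/-- ★★ **Three-door zeros ⟺ balanced masses** (door `S` closed): `VF(d) = 0 ↔ M_N = M_E`.
[cite: GlazmanManolescu2019, Lemma 2.1 (statement, "in the form given in [Gl]")] [cite: Glazman2015WeightedSAW, Lemma 3.1, eq. (1) (the weight v(θ))] -/
theorem vertexFunctional_printed_farSW_eq_zero_iff_of_S_closed {θ : ℝ} (hθ : θ ∈ Set.Icc (π / 3) (2 * π / 3))
    (Dl : List Face) (w : Face) (hf : farSW w ∈ Dl) (hh : holeFaceW w ∉ dom Dl) (hS : farSWS w ∉ dom Dl)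
    (hr : RootedFace (dom Dl) (w.side .W) (farSW w)) :
    vertexFunctional (printedWeights θ) tFiveEighths (ybCoeff θ) Dl (w.side .W) (farSW w) = 0 ↔
      ∑ ω ∈ ΩG.setB2a (dom Dl) (w.side .W) (farSW w), ΩG.firstMassD θ hr .N ω =
        ∑ ω ∈ ΩG.setB2a (dom Dl) (w.side .W) (farSW w), ΩG.firstMassD θ hr .E ω := by
  have hv : (weightV θ : ℂ) ≠ 0 := by
    have hθ' : θ ∈ Set.Ioo 0 π := ⟨by linarith [hθ.1, Real.pi_pos], by linarith [hθ.2, Real.pi_pos]⟩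
    exact_mod_cast (weightV_pos_of_mem_Ioo hθ').ne'
  rw [vertexFunctional_printed_farSW_eq_of_S_closed hθ Dl w hf hh hS hr]
  constructor
  · intro h0
    rcases mul_eq_zero.1 h0 with h1 | h2
    · exact absurd h1 (mul_ne_zero (mul_ne_zero Complex.I_ne_zero hv) (Complex.exp_ne_zero _))
    · exact sub_eq_zero.1 (Complex.ofReal_eq_zero.1 h2)
  · intro h0; rw [h0, sub_self]; simp

end Literature.Barriers.CriticalPhenomena.PlaquetteWalk

/-! ## § DOMINANCE at the four-door diagonal cell: near-balance of the two cone groups is necessary for a zero -/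

namespace Literature.Probability.RandomPlanarGeometry.SAW.YangBaxter

open Real Complex

section DominanceD

/-- `cos(π/8) ≤ cos x` for `|x| ≤ π/8`. [folklore] -/
private theorem cos_pi_div_eight_le {x : ℝ} (h1 : -(π / 8) ≤ x) (h2 : x ≤ π / 8) : Real.cos (π / 8) ≤ Real.cos x := by
  have hπ := Real.pi_pos
  rcases le_or_gt 0 x with hx | hx
  · exact Real.cos_le_cos_of_nonneg_of_le_pi hx (by linarith) h2
  · rw [← Real.cos_neg x]
    exact Real.cos_le_cos_of_nonneg_of_le_pi (by linarith) (by linarith) (by linarith)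

/-- `Re(e^{ia}·e^{ix}) = cos(a + x)`. [folklore] -/
private theorem re_cexp_mul_cexpD4 (a x : ℝ) :
    (Complex.exp (((a : ℝ) : ℂ) * Complex.I) * Complex.exp (((x : ℝ) : ℂ) * Complex.I)).re = Real.cos (a + x) := by
  rw [← Complex.exp_add, show ((a : ℝ) : ℂ) * Complex.I + ((x : ℝ) : ℂ) * Complex.I = (((a + x : ℝ)) : ℂ) * Complex.I by
    push_cast; ring, Complex.exp_ofReal_mul_I_re]

/-- `Re(e^{ia}) = cos a`. [folklore] -/
private theorem re_cexpD4 (a : ℝ) : (Complex.exp (((a : ℝ) : ℂ) * Complex.I)).re = Real.cos a :=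
  Complex.exp_ofReal_mul_I_re a

/-- ★ **The `N/W` group projects at least `cos(π/8)` onto the axis `e^{iπ/8}`** (`θ ∈ [π/3, 2π/3]`): for every realizable
pattern with first side `N` or `W`, `cos(π/8) ≤ Re(e^{−iπ/8}·diagDir)`. [cite: Glazman2015WeightedSAW, Lemma 3.1, eq. (1) (the weight v(θ)); lane plumbing] -/
theorem cos_le_re_rot_diagDir_of_N_or_W {θ : ℝ} (hθ : θ ∈ Set.Icc (π / 3) (2 * π / 3)) {z₀ z₁ z₂ : Side}
    (h01 : z₀ ≠ z₁) (h02 : z₀ ≠ z₂) (h12 : z₁ ≠ z₂) (hW : z₀ = .W → z₁ ≠ .N ∧ z₂ ≠ .N) (hz : z₀ = .N ∨ z₀ = .W) :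
    Real.cos (π / 8) ≤ (Complex.exp ((((-(π / 8) : ℝ)) : ℂ) * Complex.I) * diagDir θ z₀ z₁ z₂).re := by
  have hπ := Real.pi_pos
  obtain ⟨h1, h2⟩ := hθ
  have c1 : Real.cos (π / 8) ≤ (Complex.exp ((((-(π / 8) : ℝ)) : ℂ) * Complex.I) * 1).re := by
    rw [mul_one, re_cexpD4, Real.cos_neg]
  have c2 : Real.cos (π / 8) ≤ (Complex.exp ((((-(π / 8) : ℝ)) : ℂ) * Complex.I) *
      Complex.exp ((((π / 8 : ℝ)) : ℂ) * Complex.I)).re := by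
    rw [re_cexp_mul_cexpD4]; exact cos_pi_div_eight_le (by linarith) (by linarith)
  have c3 : Real.cos (π / 8) ≤ (Complex.exp ((((-(π / 8) : ℝ)) : ℂ) * Complex.I) *
      Complex.exp ((((3 * θ / 8 - π / 8 : ℝ)) : ℂ) * Complex.I)).re := by
    rw [re_cexp_mul_cexpD4]; exact cos_pi_div_eight_le (by linarith) (by linarith)
  have c4 : Real.cos (π / 8) ≤ (Complex.exp ((((-(π / 8) : ℝ)) : ℂ) * Complex.I) *
      Complex.exp ((((3 * θ / 8 : ℝ)) : ℂ) * Complex.I)).re := by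
    rw [re_cexp_mul_cexpD4]; exact cos_pi_div_eight_le (by linarith) (by linarith)
  revert h01 h02 h12 hW hz
  cases z₀ <;> cases z₁ <;> cases z₂ <;> intro h01 h02 h12 hW hz <;> simp only [diagDir] <;>
    first
    | exact absurd rfl h01
    | exact absurd rfl h02
    | exact absurd rfl h12
    | exact absurd rfl (hW rfl).1
    | exact absurd rfl (hW rfl).2
    | (exfalso; rcases hz with hz | hz <;> exact absurd hz (by decide))
    | exact c1
    | exact c2
    | exact c3
    | exact c4

/-- ★ **The `E/S` group projects at least `cos(π/8)` onto the opposite axis `e^{i9π/8}`**: for every realizable pattern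
with first side `E` or `S`, `cos(π/8) ≤ Re(e^{−i9π/8}·diagDir)`. [cite: Glazman2015WeightedSAW, Lemma 3.1, eq. (1) (the weight v(θ)); lane plumbing] -/
theorem cos_le_re_rot_diagDir_of_E_or_S {θ : ℝ} (hθ : θ ∈ Set.Icc (π / 3) (2 * π / 3)) {z₀ z₁ z₂ : Side}
    (h01 : z₀ ≠ z₁) (h02 : z₀ ≠ z₂) (h12 : z₁ ≠ z₂) (hS : z₀ = .S → z₁ ≠ .E ∧ z₂ ≠ .E) (hz : z₀ = .E ∨ z₀ = .S) :
    Real.cos (π / 8) ≤ (Complex.exp ((((-(9 * π / 8) : ℝ)) : ℂ) * Complex.I) * diagDir θ z₀ z₁ z₂).re := by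
  have hπ := Real.pi_pos
  obtain ⟨h1, h2⟩ := hθ
  have c1 : Real.cos (π / 8) ≤ (Complex.exp ((((-(9 * π / 8) : ℝ)) : ℂ) * Complex.I) *
      Complex.exp ((((-(7 * π / 8) : ℝ)) : ℂ) * Complex.I)).re := by
    rw [re_cexp_mul_cexpD4, show -(9 * π / 8) + -(7 * π / 8) = 0 - 2 * π by ring, Real.cos_sub_two_pi, Real.cos_zero]
    exact Real.cos_le_one _
  have c2 : Real.cos (π / 8) ≤ (Complex.exp ((((-(9 * π / 8) : ℝ)) : ℂ) * Complex.I) *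
      Complex.exp ((((3 * θ / 8 - π : ℝ)) : ℂ) * Complex.I)).re := by
    rw [re_cexp_mul_cexpD4, show -(9 * π / 8) + (3 * θ / 8 - π) = (3 * θ / 8 - π / 8) - 2 * π by ring, Real.cos_sub_two_pi]
    exact cos_pi_div_eight_le (by linarith) (by linarith)
  have c3 : Real.cos (π / 8) ≤ (Complex.exp ((((-(9 * π / 8) : ℝ)) : ℂ) * Complex.I) *
      Complex.exp ((((3 * θ / 8 - 9 * π / 8 : ℝ)) : ℂ) * Complex.I)).re := by
    rw [re_cexp_mul_cexpD4, show -(9 * π / 8) + (3 * θ / 8 - 9 * π / 8) = (3 * θ / 8 - π / 4) - 2 * π by ring,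
      Real.cos_sub_two_pi]
    exact cos_pi_div_eight_le (by linarith) (by linarith)
  have c4 : Real.cos (π / 8) ≤ (Complex.exp ((((-(9 * π / 8) : ℝ)) : ℂ) * Complex.I) * (-1)).re := by
    rw [mul_neg_one, Complex.neg_re, re_cexpD4, show -(9 * π / 8) = -(π / 8) - π by ring, Real.cos_sub_pi, neg_neg,
      Real.cos_neg]
  revert h01 h02 h12 hS hz
  cases z₀ <;> cases z₁ <;> cases z₂ <;> intro h01 h02 h12 hS hz <;> simp only [diagDir] <;>
    first
    | exact absurd rfl h01
    | exact absurd rfl h02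
    | exact absurd rfl h12
    | exact absurd rfl (hS rfl).1
    | exact absurd rfl (hS rfl).2
    | (exfalso; rcases hz with hz | hz <;> exact absurd hz (by decide))
    | exact c1
    | exact c2
    | exact c3
    | exact c4

end DominanceD

namespace ΩG

variable {D : Set Face} {w : Face}

/-- The rotated class term is bounded below by minus the exterior weight (any rotation). [cite: GlazmanManolescu2019, eq. (1) (the weights are non-negative)] -/
theorem neg_extWeight_le_re_rot_diagClassTerm (hh : holeFaceW w ∉ D) {θ : ℝ} (hθ : θ ∈ Set.Icc (π / 3) (2 * π / 3))
    (hr : RootedFace D (w.side .W) (farSW w)) (ω : ΩG D (w.side .W) (farSW w)) (h : ω.IsB2a) (a : ℝ) :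
    -ω.2.extWeight (fun _ => θ) (farSW w) ≤ (Complex.exp (((a : ℝ) : ℂ) * Complex.I) * diagClassTerm θ hr ω).re := by
  have hn := norm_diagClassTerm_le hh hθ hr ω h
  have h1 : ‖Complex.exp (((a : ℝ) : ℂ) * Complex.I) * diagClassTerm θ hr ω‖ ≤ ω.2.extWeight (fun _ => θ) (farSW w) := by
    rw [norm_mul, Complex.norm_exp_ofReal_mul_I, one_mul]; exact hn
  have h2 := Complex.abs_re_le_norm (Complex.exp (((a : ℝ) : ℂ) * Complex.I) * diagClassTerm θ hr ω)
  have h3 := neg_abs_le (Complex.exp (((a : ℝ) : ℂ) * Complex.I) * diagClassTerm θ hr ω).re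
  linarith

/-- ★ **Per-walk dominance inequality (axis `e^{iπ/8}`)**: for every class-`B2a` walk at the diagonal cell,
`cos(π/8)·(firstMass_N + firstMass_W) − (firstMass_E + firstMass_S) ≤ Re(e^{−iπ/8}·diagClassTerm)`.
[cite: GlazmanManolescu2019, Lemma 2.1 (statement, "in the form given in [Gl]")] [cite: Glazman2015WeightedSAW, Lemma 3.1, eq. (1) (the weight v(θ))] -/
theorem dominance_term_NW (hh : holeFaceW w ∉ D) {θ : ℝ} (hθ : θ ∈ Set.Icc (π / 3) (2 * π / 3))
    (hr : RootedFace D (w.side .W) (farSW w)) (ω : ΩG D (w.side .W) (farSW w)) (h : ω.IsB2a) :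
    Real.cos (π / 8) * (firstMassD θ hr .N ω + firstMassD θ hr .W ω) - (firstMassD θ hr .E ω + firstMassD θ hr .S ω) ≤
      (Complex.exp ((((-(π / 8) : ℝ)) : ℂ) * Complex.I) * diagClassTerm θ hr ω).re := by
  obtain ⟨hz01, hz02, hz12⟩ := ω.firstSide_exit_return_distinct hr h
  obtain ⟨hexS, hexW⟩ := farSW_entry_exit_exclusion hh hr h
  have hext : 0 ≤ ω.2.extWeight (fun _ => θ) (farSW w) := Finset.prod_nonneg fun _ _ => localWeight_nonneg hθ _
  have hcos : 0 ≤ Real.cos (π / 8) := Real.cos_nonneg_of_mem_Icc ⟨by linarith [Real.pi_pos], by linarith [Real.pi_pos]⟩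
  have hlow := neg_extWeight_le_re_rot_diagClassTerm hh hθ hr ω h (-(π / 8))
  unfold firstMassD
  rw [dif_pos h, dif_pos h, dif_pos h, dif_pos h]
  by_cases hw : ω.WE (fun _ => θ) ≠ excursionWinding θ ω.2.firstSideG (ω.z1 hr h) ω.1
  · have key : (Complex.exp ((((-(π / 8) : ℝ)) : ℂ) * Complex.I) * diagClassTerm θ hr ω).re =
        ω.2.extWeight (fun _ => θ) (farSW w) *
          (Complex.exp ((((-(π / 8) : ℝ)) : ℂ) * Complex.I) * diagDir θ ω.2.firstSideG (ω.z1 hr h) ω.1).re := by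
      rw [diagClassTerm, dif_pos h, if_pos hw, show Complex.exp ((((-(π / 8) : ℝ)) : ℂ) * Complex.I) *
          ((ω.2.extWeight (fun _ => θ) (farSW w) : ℂ) * diagDir θ ω.2.firstSideG (ω.z1 hr h) ω.1) =
          (ω.2.extWeight (fun _ => θ) (farSW w) : ℂ) *
            (Complex.exp ((((-(π / 8) : ℝ)) : ℂ) * Complex.I) * diagDir θ ω.2.firstSideG (ω.z1 hr h) ω.1) by ring,
        Complex.re_ofReal_mul]
    rcases hz : ω.2.firstSideG with _ | _ | _ | _
    · -- W
      have hd := cos_le_re_rot_diagDir_of_N_or_W hθ hz01 hz02 hz12 hexW (Or.inr hz)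
      rw [hz] at hw
      rw [if_neg (fun H => absurd H.1 (by decide)), if_pos ⟨rfl, hw⟩, if_neg (fun H => absurd H.1 (by decide)),
        if_neg (fun H => absurd H.1 (by decide)), key]
      rw [hz] at hd ⊢
      nlinarith
    · -- E
      rw [hz] at hw
      rw [if_neg (fun H => absurd H.1 (by decide)), if_neg (fun H => absurd H.1 (by decide)), if_pos ⟨rfl, hw⟩,
        if_neg (fun H => absurd H.1 (by decide))]
      nlinarith
    · -- S
      rw [hz] at hw
      rw [if_neg (fun H => absurd H.1 (by decide)), if_neg (fun H => absurd H.1 (by decide)),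
        if_neg (fun H => absurd H.1 (by decide)), if_pos ⟨rfl, hw⟩]
      nlinarith
    · -- N
      have hd := cos_le_re_rot_diagDir_of_N_or_W hθ hz01 hz02 hz12 hexW (Or.inl hz)
      rw [hz] at hw
      rw [if_pos ⟨rfl, hw⟩, if_neg (fun H => absurd H.1 (by decide)), if_neg (fun H => absurd H.1 (by decide)),
        if_neg (fun H => absurd H.1 (by decide)), key]
      rw [hz] at hd ⊢
      nlinarith
  · rw [if_neg (fun H => hw H.2), if_neg (fun H => hw H.2), if_neg (fun H => hw H.2), if_neg (fun H => hw H.2),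
      diagClassTerm, dif_pos h, if_neg hw]
    simp

/-- ★ **Per-walk dominance inequality (axis `e^{i9π/8}`)**: `cos(π/8)·(firstMass_E + firstMass_S) − (firstMass_N + firstMass_W)
≤ Re(e^{−i9π/8}·diagClassTerm)`. [cite: GlazmanManolescu2019, Lemma 2.1 (statement, "in the form given in [Gl]")] [cite: Glazman2015WeightedSAW, Lemma 3.1, eq. (1) (the weight v(θ))] -/
theorem dominance_term_ES (hh : holeFaceW w ∉ D) {θ : ℝ} (hθ : θ ∈ Set.Icc (π / 3) (2 * π / 3))
    (hr : RootedFace D (w.side .W) (farSW w)) (ω : ΩG D (w.side .W) (farSW w)) (h : ω.IsB2a) :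
    Real.cos (π / 8) * (firstMassD θ hr .E ω + firstMassD θ hr .S ω) - (firstMassD θ hr .N ω + firstMassD θ hr .W ω) ≤
      (Complex.exp ((((-(9 * π / 8) : ℝ)) : ℂ) * Complex.I) * diagClassTerm θ hr ω).re := by
  obtain ⟨hz01, hz02, hz12⟩ := ω.firstSide_exit_return_distinct hr h
  obtain ⟨hexS, hexW⟩ := farSW_entry_exit_exclusion hh hr h
  have hext : 0 ≤ ω.2.extWeight (fun _ => θ) (farSW w) := Finset.prod_nonneg fun _ _ => localWeight_nonneg hθ _
  have hcos : 0 ≤ Real.cos (π / 8) := Real.cos_nonneg_of_mem_Icc ⟨by linarith [Real.pi_pos], by linarith [Real.pi_pos]⟩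
  have hlow := neg_extWeight_le_re_rot_diagClassTerm hh hθ hr ω h (-(9 * π / 8))
  unfold firstMassD
  rw [dif_pos h, dif_pos h, dif_pos h, dif_pos h]
  by_cases hw : ω.WE (fun _ => θ) ≠ excursionWinding θ ω.2.firstSideG (ω.z1 hr h) ω.1
  · have key : (Complex.exp ((((-(9 * π / 8) : ℝ)) : ℂ) * Complex.I) * diagClassTerm θ hr ω).re =
        ω.2.extWeight (fun _ => θ) (farSW w) *
          (Complex.exp ((((-(9 * π / 8) : ℝ)) : ℂ) * Complex.I) * diagDir θ ω.2.firstSideG (ω.z1 hr h) ω.1).re := by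
      rw [diagClassTerm, dif_pos h, if_pos hw, show Complex.exp ((((-(9 * π / 8) : ℝ)) : ℂ) * Complex.I) *
          ((ω.2.extWeight (fun _ => θ) (farSW w) : ℂ) * diagDir θ ω.2.firstSideG (ω.z1 hr h) ω.1) =
          (ω.2.extWeight (fun _ => θ) (farSW w) : ℂ) *
            (Complex.exp ((((-(9 * π / 8) : ℝ)) : ℂ) * Complex.I) * diagDir θ ω.2.firstSideG (ω.z1 hr h) ω.1) by ring,
        Complex.re_ofReal_mul]
    rcases hz : ω.2.firstSideG with _ | _ | _ | _
    · -- W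
      rw [hz] at hw
      rw [if_neg (fun H => absurd H.1 (by decide)), if_neg (fun H => absurd H.1 (by decide)),
        if_neg (fun H => absurd H.1 (by decide)), if_pos ⟨rfl, hw⟩]
      nlinarith
    · -- E
      have hd := cos_le_re_rot_diagDir_of_E_or_S hθ hz01 hz02 hz12 hexS (Or.inl hz)
      rw [hz] at hw
      rw [if_pos ⟨rfl, hw⟩, if_neg (fun H => absurd H.1 (by decide)), if_neg (fun H => absurd H.1 (by decide)),
        if_neg (fun H => absurd H.1 (by decide)), key]
      rw [hz] at hd ⊢
      nlinarith
    · -- S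
      have hd := cos_le_re_rot_diagDir_of_E_or_S hθ hz01 hz02 hz12 hexS (Or.inr hz)
      rw [hz] at hw
      rw [if_neg (fun H => absurd H.1 (by decide)), if_pos ⟨rfl, hw⟩, if_neg (fun H => absurd H.1 (by decide)),
        if_neg (fun H => absurd H.1 (by decide)), key]
      rw [hz] at hd ⊢
      nlinarith
    · -- N
      rw [hz] at hw
      rw [if_neg (fun H => absurd H.1 (by decide)), if_neg (fun H => absurd H.1 (by decide)), if_pos ⟨rfl, hw⟩,
        if_neg (fun H => absurd H.1 (by decide))]
      nlinarith
  · rw [if_neg (fun H => hw H.2), if_neg (fun H => hw H.2), if_neg (fun H => hw H.2), if_neg (fun H => hw H.2),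
      diagClassTerm, dif_pos h, if_neg hw]
    simp

end ΩG

end Literature.Probability.RandomPlanarGeometry.SAW.YangBaxter

namespace Literature.Barriers.CriticalPhenomena.PlaquetteWalk

open Literature.Probability.RandomPlanarGeometry.SAW.YangBaxter
open Real Complex

/-- ★★★ **THE DOMINANCE LAW AT THE DIAGONAL CELL.** For `θ ∈ [π/3, 2π/3]`: if the wound mass of the `N/W` group,
discounted by `cos(π/8) ≈ 0.924`, exceeds the wound mass of the `E/S` group —
`Σ (firstMass_E + firstMass_S) < cos(π/8)·Σ (firstMass_N + firstMass_W)` — then `VF_D(w.side W, d) ≠ 0`. (The two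
groups live in antipodal cones of opening `π/4`; a zero of the defect at the four-door diagonal cell therefore requires
the two group masses to agree up to the factor `cos(π/8)`. The cone laws are the case of an empty `E/S` group.)
[cite: GlazmanManolescu2019, Lemma 2.1 (statement, "in the form given in [Gl]")] [cite: Glazman2015WeightedSAW, Lemma 3.1 (proof, pp. 6–7)]
[cite: Hopf1935, Nr. 2 (Umlaufsatz, p. 53) and Nr. 4 eq. (22) (curves with corners, pp. 60–61)] -/
theorem vertexFunctional_printed_farSW_ne_zero_of_NW_dominant {θ : ℝ} (hθ : θ ∈ Set.Icc (π / 3) (2 * π / 3))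
    (Dl : List Face) (w : Face) (hf : farSW w ∈ Dl) (hh : holeFaceW w ∉ dom Dl)
    (hr : RootedFace (dom Dl) (w.side .W) (farSW w))
    (hdom : ∑ ω ∈ ΩG.setB2a (dom Dl) (w.side .W) (farSW w), (ΩG.firstMassD θ hr .E ω + ΩG.firstMassD θ hr .S ω) <
      Real.cos (π / 8) * ∑ ω ∈ ΩG.setB2a (dom Dl) (w.side .W) (farSW w), (ΩG.firstMassD θ hr .N ω + ΩG.firstMassD θ hr .W ω)) :
    vertexFunctional (printedWeights θ) tFiveEighths (ybCoeff θ) Dl (w.side .W) (farSW w) ≠ 0 := by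
  classical
  have hv : (weightV θ : ℂ) ≠ 0 := by
    have hθ0 : θ ∈ Set.Ioo 0 π := ⟨by linarith [hθ.1, Real.pi_pos], by linarith [hθ.2, Real.pi_pos]⟩
    exact_mod_cast (weightV_pos_of_mem_Ioo hθ0).ne'
  rw [vertexFunctional_printed_farSW_eq hθ Dl w hf hh hr]
  refine mul_ne_zero (mul_ne_zero Complex.I_ne_zero hv) fun h0 => ?_
  set ρ : ℂ := Complex.exp ((((-(π / 8) : ℝ)) : ℂ) * Complex.I) with hρ
  have hsum : Real.cos (π / 8) * ∑ ω ∈ ΩG.setB2a (dom Dl) (w.side .W) (farSW w),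
        (ΩG.firstMassD θ hr .N ω + ΩG.firstMassD θ hr .W ω) -
      ∑ ω ∈ ΩG.setB2a (dom Dl) (w.side .W) (farSW w), (ΩG.firstMassD θ hr .E ω + ΩG.firstMassD θ hr .S ω) ≤
      (ρ * ∑ ω ∈ ΩG.setB2a (dom Dl) (w.side .W) (farSW w), ΩG.diagClassTerm θ hr ω).re := by
    rw [Finset.mul_sum, Finset.mul_sum, Complex.re_sum, ← Finset.sum_sub_distrib]
    refine Finset.sum_le_sum fun ω hω => ?_
    simp only [ΩG.setB2a, Finset.mem_filter, Finset.mem_univ, true_and] at hω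
    have hB : ω.IsB2a := hω
    exact ΩG.dominance_term_NW hh hθ hr ω hB
  rw [h0, mul_zero, Complex.zero_re] at hsum
  linarith

/-- ★★★ **THE DOMINANCE LAW, `E/S`-dominant form**: `Σ (firstMass_N + firstMass_W) < cos(π/8)·Σ (firstMass_E + firstMass_S)
⇒ VF_D(w.side W, d) ≠ 0`. [cite: GlazmanManolescu2019, Lemma 2.1 (statement, "in the form given in [Gl]")] [cite: Glazman2015WeightedSAW, Lemma 3.1 (proof, pp. 6–7)]
[cite: Hopf1935, Nr. 2 (Umlaufsatz, p. 53) and Nr. 4 eq. (22) (curves with corners, pp. 60–61)] -/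
theorem vertexFunctional_printed_farSW_ne_zero_of_ES_dominant {θ : ℝ} (hθ : θ ∈ Set.Icc (π / 3) (2 * π / 3))
    (Dl : List Face) (w : Face) (hf : farSW w ∈ Dl) (hh : holeFaceW w ∉ dom Dl)
    (hr : RootedFace (dom Dl) (w.side .W) (farSW w))
    (hdom : ∑ ω ∈ ΩG.setB2a (dom Dl) (w.side .W) (farSW w), (ΩG.firstMassD θ hr .N ω + ΩG.firstMassD θ hr .W ω) <
      Real.cos (π / 8) * ∑ ω ∈ ΩG.setB2a (dom Dl) (w.side .W) (farSW w), (ΩG.firstMassD θ hr .E ω + ΩG.firstMassD θ hr .S ω)) :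
    vertexFunctional (printedWeights θ) tFiveEighths (ybCoeff θ) Dl (w.side .W) (farSW w) ≠ 0 := by
  classical
  have hv : (weightV θ : ℂ) ≠ 0 := by
    have hθ0 : θ ∈ Set.Ioo 0 π := ⟨by linarith [hθ.1, Real.pi_pos], by linarith [hθ.2, Real.pi_pos]⟩
    exact_mod_cast (weightV_pos_of_mem_Ioo hθ0).ne'
  rw [vertexFunctional_printed_farSW_eq hθ Dl w hf hh hr]
  refine mul_ne_zero (mul_ne_zero Complex.I_ne_zero hv) fun h0 => ?_
  set ρ : ℂ := Complex.exp ((((-(9 * π / 8) : ℝ)) : ℂ) * Complex.I) with hρ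
  have hsum : Real.cos (π / 8) * ∑ ω ∈ ΩG.setB2a (dom Dl) (w.side .W) (farSW w),
        (ΩG.firstMassD θ hr .E ω + ΩG.firstMassD θ hr .S ω) -
      ∑ ω ∈ ΩG.setB2a (dom Dl) (w.side .W) (farSW w), (ΩG.firstMassD θ hr .N ω + ΩG.firstMassD θ hr .W ω) ≤
      (ρ * ∑ ω ∈ ΩG.setB2a (dom Dl) (w.side .W) (farSW w), ΩG.diagClassTerm θ hr ω).re := by
    rw [Finset.mul_sum, Finset.mul_sum, Complex.re_sum, ← Finset.sum_sub_distrib]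
    refine Finset.sum_le_sum fun ω hω => ?_
    simp only [ΩG.setB2a, Finset.mem_filter, Finset.mem_univ, true_and] at hω
    have hB : ω.IsB2a := hω
    exact ΩG.dominance_term_ES hh hθ hr ω hB
  rw [h0, mul_zero, Complex.zero_re] at hsum
  linarith

end Literature.Barriers.CriticalPhenomena.PlaquetteWalk

/-! ## § PAIRING at the diagonal cell: the eight realizable patterns form four antipodal pairs indexed by the FREE side;
the defect is a signed sum over the four free sides -/

namespace Literature.Probability.RandomPlanarGeometry.SAW.YangBaxter

open Real Complex

section PairingD

/-- The first side of the `+` pattern whose free (fourth) side is the argument: `W ↦ N`, `S ↦ N`, `E ↦ N`, `N ↦ W`.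
[cite: GlazmanManolescu2019, Lemma 2.1 (statement, "in the form given in [Gl]"); lane plumbing] -/
def pairPlus : Side → Side
  | .W => .N
  | .S => .N
  | .E => .N
  | .N => .W

/-- The first side of the `−` pattern whose free (fourth) side is the argument: `W ↦ E`, `S ↦ E`, `E ↦ S`, `N ↦ E`.
[cite: GlazmanManolescu2019, Lemma 2.1 (statement, "in the form given in [Gl]"); lane plumbing] -/
def pairMinus : Side → Side
  | .W => .E
  | .S => .E
  | .E => .S
  | .N => .E

/-- **The pair direction indexed by the free side**: `W ↦ e^{iπ/8}`, `S ↦ e^{i(3θ/8 − π/8)}`, `E ↦ 1`, `N ↦ e^{i·3θ/8}`.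
[cite: Glazman2015WeightedSAW, Lemma 3.1, eq. (1) (the weight v(θ)); lane plumbing] -/
def pairDir (θ : ℝ) : Side → ℂ
  | .W => Complex.exp ((((π / 8 : ℝ)) : ℂ) * Complex.I)
  | .S => Complex.exp ((((3 * θ / 8 - π / 8 : ℝ)) : ℂ) * Complex.I)
  | .E => 1
  | .N => Complex.exp ((((3 * θ / 8 : ℝ)) : ℂ) * Complex.I)

/-- `e^{i(x − π)} = −e^{ix}`. [folklore] -/
private theorem cexp_sub_piD4 (x : ℝ) :
    Complex.exp ((((x - π : ℝ)) : ℂ) * Complex.I) = -Complex.exp (((x : ℝ) : ℂ) * Complex.I) := by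
  rw [show (((x - π : ℝ)) : ℂ) * Complex.I = ((x : ℝ) : ℂ) * Complex.I + (-(π : ℂ) * Complex.I) by push_cast; ring,
    Complex.exp_add, show -(π : ℂ) * Complex.I = -((π : ℂ) * Complex.I) by ring, Complex.exp_neg, Complex.exp_pi_mul_I]
  ring

/-- ★★ **THE PAIRING OF THE PATTERNS AT THE DIAGONAL CELL**: a realizable pattern `(z₀; z₁, z₂)` with free side `z₃` is
either the `+` pattern of `z₃` (first side `pairPlus z₃`, direction `pairDir θ z₃`) or the `−` pattern of `z₃` (first side
`pairMinus z₃`, direction `−pairDir θ z₃`): the eight realizable patterns form four antipodal pairs.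
[cite: GlazmanManolescu2019, Lemma 2.1 (statement, "in the form given in [Gl]")] [cite: Glazman2015WeightedSAW, Lemma 3.1, eq. (1) (the weight v(θ))] -/
theorem diagDir_pairing (θ : ℝ) {z₀ z₁ z₂ z₃ : Side} (h01 : z₀ ≠ z₁) (h02 : z₀ ≠ z₂) (h12 : z₁ ≠ z₂)
    (h3 : z₃ ≠ z₀ ∧ z₃ ≠ z₁ ∧ z₃ ≠ z₂) (hS : z₀ = .S → z₁ ≠ .E ∧ z₂ ≠ .E) (hW : z₀ = .W → z₁ ≠ .N ∧ z₂ ≠ .N) :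
    (z₀ = pairPlus z₃ ∧ diagDir θ z₀ z₁ z₂ = pairDir θ z₃) ∨ (z₀ = pairMinus z₃ ∧ diagDir θ z₀ z₁ z₂ = -pairDir θ z₃) := by
  have n1 : Complex.exp ((((-(7 * π / 8) : ℝ)) : ℂ) * Complex.I) = -Complex.exp ((((π / 8 : ℝ)) : ℂ) * Complex.I) := by
    rw [← cexp_sub_piD4, show (π / 8 - π : ℝ) = -(7 * π / 8) by ring]
  have n2 : Complex.exp ((((3 * θ / 8 - 9 * π / 8 : ℝ)) : ℂ) * Complex.I) =
      -Complex.exp ((((3 * θ / 8 - π / 8 : ℝ)) : ℂ) * Complex.I) := by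
    rw [← cexp_sub_piD4, show (3 * θ / 8 - π / 8 - π : ℝ) = 3 * θ / 8 - 9 * π / 8 by ring]
  have n3 : Complex.exp ((((3 * θ / 8 - π : ℝ)) : ℂ) * Complex.I) = -Complex.exp ((((3 * θ / 8 : ℝ)) : ℂ) * Complex.I) :=
    cexp_sub_piD4 _
  revert h01 h02 h12 h3 hS hW
  cases z₀ <;> cases z₁ <;> cases z₂ <;> cases z₃ <;> intro h01 h02 h12 h3 hS hW <;>
    first
    | exact absurd rfl h01
    | exact absurd rfl h02
    | exact absurd rfl h12
    | exact absurd rfl h3.1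
    | exact absurd rfl h3.2.1
    | exact absurd rfl h3.2.2
    | exact absurd rfl (hS rfl).1
    | exact absurd rfl (hS rfl).2
    | exact absurd rfl (hW rfl).1
    | exact absurd rfl (hW rfl).2
    | exact Or.inl ⟨rfl, rfl⟩
    | exact Or.inr ⟨rfl, n1⟩
    | exact Or.inr ⟨rfl, n2⟩
    | exact Or.inr ⟨rfl, n3⟩
    | exact Or.inr ⟨rfl, rfl⟩

/-- Every pair direction projects at least `cos(π/8)` onto the axis `e^{iπ/8}` (`θ ∈ [π/3, 2π/3]`). [cite: Glazman2015WeightedSAW, Lemma 3.1, eq. (1) (the weight v(θ)); lane plumbing] -/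
theorem cos_le_re_rot_pairDir {θ : ℝ} (hθ : θ ∈ Set.Icc (π / 3) (2 * π / 3)) (z₃ : Side) :
    Real.cos (π / 8) ≤ (Complex.exp ((((-(π / 8) : ℝ)) : ℂ) * Complex.I) * pairDir θ z₃).re := by
  have hπ := Real.pi_pos
  obtain ⟨h1, h2⟩ := hθ
  cases z₃ <;> simp only [pairDir]
  · rw [re_cexp_mul_cexpD4, show -(π / 8) + π / 8 = (0 : ℝ) by ring, Real.cos_zero]; exact Real.cos_le_one _
  · rw [mul_one, re_cexpD4, Real.cos_neg]
  · rw [re_cexp_mul_cexpD4]; exact cos_pi_div_eight_le (by linarith) (by linarith)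
  · rw [re_cexp_mul_cexpD4]; exact cos_pi_div_eight_le (by linarith) (by linarith)

end PairingD

namespace ΩG

variable {D : Set Face} {w : Face}

open Classical in
/-- **The `+` pattern mass of the free side `z₃`** at the diagonal cell: the exterior weight of a WOUND class-`B2a` walk whose
free side is `z₃` and whose first side is `pairPlus z₃`, else `0`. [cite: GlazmanManolescu2019, Lemma 2.1 (statement, "in the form given in [Gl]")] -/
noncomputable def plusMassD (θ : ℝ) (hr : RootedFace D (w.side .W) (farSW w)) (z₃ : Side)
    (ω : ΩG D (w.side .W) (farSW w)) : ℝ :=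
  if h : ω.IsB2a then
    (if ω.z₃ hr h = z₃ ∧ ω.2.firstSideG = pairPlus z₃ ∧ ω.WE (fun _ => θ) ≠ excursionWinding θ ω.2.firstSideG (ω.z1 hr h) ω.1 then
      ω.2.extWeight (fun _ => θ) (farSW w) else 0)
  else 0

open Classical in
/-- **The `−` pattern mass of the free side `z₃`** at the diagonal cell (first side `pairMinus z₃`). [cite: GlazmanManolescu2019, Lemma 2.1 (statement, "in the form given in [Gl]")] -/
noncomputable def minusMassD (θ : ℝ) (hr : RootedFace D (w.side .W) (farSW w)) (z₃ : Side)
    (ω : ΩG D (w.side .W) (farSW w)) : ℝ :=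
  if h : ω.IsB2a then
    (if ω.z₃ hr h = z₃ ∧ ω.2.firstSideG = pairMinus z₃ ∧ ω.WE (fun _ => θ) ≠ excursionWinding θ ω.2.firstSideG (ω.z1 hr h) ω.1 then
      ω.2.extWeight (fun _ => θ) (farSW w) else 0)
  else 0

/-- Pattern masses are non-negative on `[π/3, 2π/3]`. [cite: GlazmanManolescu2019, eq. (1) (the weights are non-negative)] -/
theorem plusMassD_nonneg {θ : ℝ} (hθ : θ ∈ Set.Icc (π / 3) (2 * π / 3)) (hr : RootedFace D (w.side .W) (farSW w))
    (z₃ : Side) (ω : ΩG D (w.side .W) (farSW w)) : 0 ≤ plusMassD θ hr z₃ ω := by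
  unfold plusMassD
  split_ifs
  · exact Finset.prod_nonneg fun _ _ => localWeight_nonneg hθ _
  · exact le_rfl
  · exact le_rfl

/-- Pattern masses are non-negative on `[π/3, 2π/3]`. [cite: GlazmanManolescu2019, eq. (1) (the weights are non-negative)] -/
theorem minusMassD_nonneg {θ : ℝ} (hθ : θ ∈ Set.Icc (π / 3) (2 * π / 3)) (hr : RootedFace D (w.side .W) (farSW w))
    (z₃ : Side) (ω : ΩG D (w.side .W) (farSW w)) : 0 ≤ minusMassD θ hr z₃ ω := by
  unfold minusMassD
  split_ifs
  · exact Finset.prod_nonneg fun _ _ => localWeight_nonneg hθ _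
  · exact le_rfl
  · exact le_rfl

/-- ★★★ **THE PAIRING IDENTITY (per walk)**: the diagonal class term of every class-`B2a` walk equals
`Σ_{z₃} pairDir(z₃)·(plusMass(z₃) − minusMass(z₃))` over the four free sides. [cite: GlazmanManolescu2019, Lemma 2.1 (statement, "in the form given in [Gl]")] [cite: Glazman2015WeightedSAW, Lemma 3.1 (proof, pp. 6–7)]
[cite: Hopf1935, Nr. 2 (Umlaufsatz, p. 53) and Nr. 4 eq. (22) (curves with corners, pp. 60–61)] -/
theorem diagClassTerm_pairing (hh : holeFaceW w ∉ D) (θ : ℝ) (hr : RootedFace D (w.side .W) (farSW w))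
    (ω : ΩG D (w.side .W) (farSW w)) (h : ω.IsB2a) :
    diagClassTerm θ hr ω =
      pairDir θ .N * ((plusMassD θ hr .N ω - minusMassD θ hr .N ω : ℝ) : ℂ) +
      pairDir θ .E * ((plusMassD θ hr .E ω - minusMassD θ hr .E ω : ℝ) : ℂ) +
      pairDir θ .S * ((plusMassD θ hr .S ω - minusMassD θ hr .S ω : ℝ) : ℂ) +
      pairDir θ .W * ((plusMassD θ hr .W ω - minusMassD θ hr .W ω : ℝ) : ℂ) := by
  unfold plusMassD minusMassD
  rw [dif_pos h, dif_pos h, dif_pos h, dif_pos h, dif_pos h, dif_pos h, dif_pos h, dif_pos h]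
  by_cases hw : ω.WE (fun _ => θ) ≠ excursionWinding θ ω.2.firstSideG (ω.z1 hr h) ω.1
  · obtain ⟨hz01, hz02, hz12⟩ := ω.firstSide_exit_return_distinct hr h
    have h3 := ω.z₃_spec hr h
    obtain ⟨hexS, hexW⟩ := farSW_entry_exit_exclusion hh hr h
    rw [diagClassTerm, dif_pos h, if_pos hw]
    rcases diagDir_pairing θ hz01 hz02 hz12 ⟨h3.1, h3.2.1, h3.2.2⟩ hexS hexW with ⟨hp, hd⟩ | ⟨hp, hd⟩
    · rw [hd]
      rcases hz3 : ω.z₃ hr h with _ | _ | _ | _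
      · -- free side W
        rw [hz3] at hp
        rw [if_neg (fun H => absurd H.1 (by decide)), if_neg (fun H => absurd H.1 (by decide)), if_neg (fun H => absurd H.1 (by decide)), if_neg (fun H => absurd H.1 (by decide)), if_neg (fun H => absurd H.1 (by decide)), if_neg (fun H => absurd H.1 (by decide)), if_pos ⟨rfl, hp, hw⟩, if_neg (fun H => absurd (hp.symm.trans H.2.1) (by decide))]
        push_cast; ring
      · -- free side E
        rw [hz3] at hp
        rw [if_neg (fun H => absurd H.1 (by decide)), if_neg (fun H => absurd H.1 (by decide)), if_pos ⟨rfl, hp, hw⟩, if_neg (fun H => absurd (hp.symm.trans H.2.1) (by decide)), if_neg (fun H => absurd H.1 (by decide)), if_neg (fun H => absurd H.1 (by decide)), if_neg (fun H => absurd H.1 (by decide)), if_neg (fun H => absurd H.1 (by decide))]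
        push_cast; ring
      · -- free side S
        rw [hz3] at hp
        rw [if_neg (fun H => absurd H.1 (by decide)), if_neg (fun H => absurd H.1 (by decide)), if_neg (fun H => absurd H.1 (by decide)), if_neg (fun H => absurd H.1 (by decide)), if_pos ⟨rfl, hp, hw⟩, if_neg (fun H => absurd (hp.symm.trans H.2.1) (by decide)), if_neg (fun H => absurd H.1 (by decide)), if_neg (fun H => absurd H.1 (by decide))]
        push_cast; ring
      · -- free side N
        rw [hz3] at hp
        rw [if_pos ⟨rfl, hp, hw⟩, if_neg (fun H => absurd (hp.symm.trans H.2.1) (by decide)), if_neg (fun H => absurd H.1 (by decide)), if_neg (fun H => absurd H.1 (by decide)), if_neg (fun H => absurd H.1 (by decide)), if_neg (fun H => absurd H.1 (by decide)), if_neg (fun H => absurd H.1 (by decide)), if_neg (fun H => absurd H.1 (by decide))]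
        push_cast; ring
    · rw [hd]
      rcases hz3 : ω.z₃ hr h with _ | _ | _ | _
      · -- free side W
        rw [hz3] at hp
        rw [if_neg (fun H => absurd H.1 (by decide)), if_neg (fun H => absurd H.1 (by decide)), if_neg (fun H => absurd H.1 (by decide)), if_neg (fun H => absurd H.1 (by decide)), if_neg (fun H => absurd H.1 (by decide)), if_neg (fun H => absurd H.1 (by decide)), if_neg (fun H => absurd (hp.symm.trans H.2.1) (by decide)), if_pos ⟨rfl, hp, hw⟩]
        push_cast; ring
      · -- free side E
        rw [hz3] at hp
        rw [if_neg (fun H => absurd H.1 (by decide)), if_neg (fun H => absurd H.1 (by decide)), if_neg (fun H => absurd (hp.symm.trans H.2.1) (by decide)), if_pos ⟨rfl, hp, hw⟩, if_neg (fun H => absurd H.1 (by decide)), if_neg (fun H => absurd H.1 (by decide)), if_neg (fun H => absurd H.1 (by decide)), if_neg (fun H => absurd H.1 (by decide))]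
        push_cast; ring
      · -- free side S
        rw [hz3] at hp
        rw [if_neg (fun H => absurd H.1 (by decide)), if_neg (fun H => absurd H.1 (by decide)), if_neg (fun H => absurd H.1 (by decide)), if_neg (fun H => absurd H.1 (by decide)), if_neg (fun H => absurd (hp.symm.trans H.2.1) (by decide)), if_pos ⟨rfl, hp, hw⟩, if_neg (fun H => absurd H.1 (by decide)), if_neg (fun H => absurd H.1 (by decide))]
        push_cast; ring
      · -- free side N
        rw [hz3] at hp
        rw [if_neg (fun H => absurd (hp.symm.trans H.2.1) (by decide)), if_pos ⟨rfl, hp, hw⟩, if_neg (fun H => absurd H.1 (by decide)), if_neg (fun H => absurd H.1 (by decide)), if_neg (fun H => absurd H.1 (by decide)), if_neg (fun H => absurd H.1 (by decide)), if_neg (fun H => absurd H.1 (by decide)), if_neg (fun H => absurd H.1 (by decide))]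
        push_cast; ring
  · rw [if_neg (fun H => hw H.2.2), if_neg (fun H => hw H.2.2), if_neg (fun H => hw H.2.2), if_neg (fun H => hw H.2.2), if_neg (fun H => hw H.2.2), if_neg (fun H => hw H.2.2), if_neg (fun H => hw H.2.2), if_neg (fun H => hw H.2.2),
      diagClassTerm, dif_pos h, if_neg hw]
    push_cast; ring

/-- ★ Per-walk signed projection: `cos(π/8)·Σ_{z₃}(plusMass − minusMass)` is at most `Re(e^{−iπ/8}·diagClassTerm)` whenever every
difference is non-negative… stated linearly: `Re(e^{−iπ/8}·diagClassTerm) = Σ_{z₃} Re(e^{−iπ/8}·pairDir z₃)·(plusMass z₃ − minusMass z₃)`.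
[cite: GlazmanManolescu2019, Lemma 2.1 (statement, "in the form given in [Gl]")] [cite: Glazman2015WeightedSAW, Lemma 3.1 (proof, pp. 6–7)] -/
theorem re_rot_diagClassTerm_pairing (hh : holeFaceW w ∉ D) (θ : ℝ) (hr : RootedFace D (w.side .W) (farSW w))
    (ω : ΩG D (w.side .W) (farSW w)) (h : ω.IsB2a) :
    (Complex.exp ((((-(π / 8) : ℝ)) : ℂ) * Complex.I) * diagClassTerm θ hr ω).re =
      (Complex.exp ((((-(π / 8) : ℝ)) : ℂ) * Complex.I) * pairDir θ .N).re * (plusMassD θ hr .N ω - minusMassD θ hr .N ω) +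
      (Complex.exp ((((-(π / 8) : ℝ)) : ℂ) * Complex.I) * pairDir θ .E).re * (plusMassD θ hr .E ω - minusMassD θ hr .E ω) +
      (Complex.exp ((((-(π / 8) : ℝ)) : ℂ) * Complex.I) * pairDir θ .S).re * (plusMassD θ hr .S ω - minusMassD θ hr .S ω) +
      (Complex.exp ((((-(π / 8) : ℝ)) : ℂ) * Complex.I) * pairDir θ .W).re * (plusMassD θ hr .W ω - minusMassD θ hr .W ω) := by
  rw [diagClassTerm_pairing hh θ hr ω h]
  simp only [mul_add, Complex.add_re, ← mul_assoc, Complex.re_mul_ofReal]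

end ΩG

end Literature.Probability.RandomPlanarGeometry.SAW.YangBaxter

namespace Literature.Barriers.CriticalPhenomena.PlaquetteWalk

open Literature.Probability.RandomPlanarGeometry.SAW.YangBaxter
open Real Complex

/-- ★★★ **THE PAIRING LAW AT THE DIAGONAL CELL.** For `θ ∈ [π/3, 2π/3]`, `d = farSW w ∈ Dl`, `h ∉ D`, `(w.side W, d)` rooted:
`VF_D(w.side W, d) = i·v(θ)·Σ_{z₃ ∈ {N,E,S,W}} pairDir(θ, z₃)·(P(z₃) − M(z₃))`, where `P(z₃)` / `M(z₃)` are the total wound masses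
of the `+` / `−` pattern with free side `z₃` (`pairDir`: `N ↦ e^{i3θ/8}`, `E ↦ 1`, `S ↦ e^{i(3θ/8−π/8)}`, `W ↦ e^{iπ/8}`). The defect at
the diagonal cell is a signed sum over the four FREE sides with directions in the arc `[0, π/4]`; the three-door laws (one pair
survives) and the cone / dominance laws are its shadows. [cite: GlazmanManolescu2019, Lemma 2.1 (statement, "in the form given in [Gl]")]
[cite: Glazman2015WeightedSAW, Lemma 3.1 (proof, pp. 6–7)] [cite: Hopf1935, Nr. 2 (Umlaufsatz, p. 53) and Nr. 4 eq. (22) (curves with corners, pp. 60–61)] -/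
theorem vertexFunctional_printed_farSW_pairing {θ : ℝ} (hθ : θ ∈ Set.Icc (π / 3) (2 * π / 3))
    (Dl : List Face) (w : Face) (hf : farSW w ∈ Dl) (hh : holeFaceW w ∉ dom Dl)
    (hr : RootedFace (dom Dl) (w.side .W) (farSW w)) :
    vertexFunctional (printedWeights θ) tFiveEighths (ybCoeff θ) Dl (w.side .W) (farSW w) =
      Complex.I * (weightV θ : ℂ) *
        (pairDir θ .N * ((∑ ω ∈ ΩG.setB2a (dom Dl) (w.side .W) (farSW w), ΩG.plusMassD θ hr .N ω - ∑ ω ∈ ΩG.setB2a (dom Dl) (w.side .W) (farSW w), ΩG.minusMassD θ hr .N ω : ℝ) : ℂ) +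
        pairDir θ .E * ((∑ ω ∈ ΩG.setB2a (dom Dl) (w.side .W) (farSW w), ΩG.plusMassD θ hr .E ω - ∑ ω ∈ ΩG.setB2a (dom Dl) (w.side .W) (farSW w), ΩG.minusMassD θ hr .E ω : ℝ) : ℂ) +
        pairDir θ .S * ((∑ ω ∈ ΩG.setB2a (dom Dl) (w.side .W) (farSW w), ΩG.plusMassD θ hr .S ω - ∑ ω ∈ ΩG.setB2a (dom Dl) (w.side .W) (farSW w), ΩG.minusMassD θ hr .S ω : ℝ) : ℂ) +
        pairDir θ .W * ((∑ ω ∈ ΩG.setB2a (dom Dl) (w.side .W) (farSW w), ΩG.plusMassD θ hr .W ω - ∑ ω ∈ ΩG.setB2a (dom Dl) (w.side .W) (farSW w), ΩG.minusMassD θ hr .W ω : ℝ) : ℂ)) := by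
  classical
  rw [vertexFunctional_printed_farSW_eq hθ Dl w hf hh hr]
  congr 1
  rw [Finset.sum_congr rfl fun ω hω => ΩG.diagClassTerm_pairing hh θ hr ω
    (by simp only [ΩG.setB2a, Finset.mem_filter, Finset.mem_univ, true_and] at hω; exact hω)]
  push_cast
  simp only [Finset.sum_add_distrib, Finset.sum_sub_distrib, ← Finset.mul_sum]

/-- ★★★ **SIGNED DOMINANCE AT THE DIAGONAL CELL**: if for every free side `z₃` the `+` mass is at least the `−` mass, and for
one free side strictly, then `VF_D(w.side W, d) ≠ 0` (all four pair directions project at least `cos(π/8) > 0` onto `e^{iπ/8}`).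
[cite: GlazmanManolescu2019, Lemma 2.1 (statement, "in the form given in [Gl]")] [cite: Glazman2015WeightedSAW, Lemma 3.1 (proof, pp. 6–7)]
[cite: Hopf1935, Nr. 2 (Umlaufsatz, p. 53) and Nr. 4 eq. (22) (curves with corners, pp. 60–61)] -/
theorem vertexFunctional_printed_farSW_ne_zero_of_plus_dominant {θ : ℝ} (hθ : θ ∈ Set.Icc (π / 3) (2 * π / 3))
    (Dl : List Face) (w : Face) (hf : farSW w ∈ Dl) (hh : holeFaceW w ∉ dom Dl)
    (hr : RootedFace (dom Dl) (w.side .W) (farSW w))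
    (hge : ∀ z₃ : Side, ∑ ω ∈ ΩG.setB2a (dom Dl) (w.side .W) (farSW w), ΩG.minusMassD θ hr z₃ ω ≤
      ∑ ω ∈ ΩG.setB2a (dom Dl) (w.side .W) (farSW w), ΩG.plusMassD θ hr z₃ ω)
    (hgt : ∃ z₃ : Side, ∑ ω ∈ ΩG.setB2a (dom Dl) (w.side .W) (farSW w), ΩG.minusMassD θ hr z₃ ω <
      ∑ ω ∈ ΩG.setB2a (dom Dl) (w.side .W) (farSW w), ΩG.plusMassD θ hr z₃ ω) :
    vertexFunctional (printedWeights θ) tFiveEighths (ybCoeff θ) Dl (w.side .W) (farSW w) ≠ 0 := by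
  classical
  have hv : (weightV θ : ℂ) ≠ 0 := by
    have hθ0 : θ ∈ Set.Ioo 0 π := ⟨by linarith [hθ.1, Real.pi_pos], by linarith [hθ.2, Real.pi_pos]⟩
    exact_mod_cast (weightV_pos_of_mem_Ioo hθ0).ne'
  have hcos : 0 < Real.cos (π / 8) := Real.cos_pos_of_mem_Ioo ⟨by linarith [Real.pi_pos], by linarith [Real.pi_pos]⟩
  rw [vertexFunctional_printed_farSW_pairing hθ Dl w hf hh hr]
  refine mul_ne_zero (mul_ne_zero Complex.I_ne_zero hv) fun h0 => ?_
  set ρ : ℂ := Complex.exp ((((-(π / 8) : ℝ)) : ℂ) * Complex.I) with hρ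
  set PN := ∑ ω ∈ ΩG.setB2a (dom Dl) (w.side .W) (farSW w), ΩG.plusMassD θ hr .N ω
  set MN := ∑ ω ∈ ΩG.setB2a (dom Dl) (w.side .W) (farSW w), ΩG.minusMassD θ hr .N ω
  set PE := ∑ ω ∈ ΩG.setB2a (dom Dl) (w.side .W) (farSW w), ΩG.plusMassD θ hr .E ω
  set ME := ∑ ω ∈ ΩG.setB2a (dom Dl) (w.side .W) (farSW w), ΩG.minusMassD θ hr .E ω
  set PS := ∑ ω ∈ ΩG.setB2a (dom Dl) (w.side .W) (farSW w), ΩG.plusMassD θ hr .S ω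
  set MS := ∑ ω ∈ ΩG.setB2a (dom Dl) (w.side .W) (farSW w), ΩG.minusMassD θ hr .S ω
  set PW := ∑ ω ∈ ΩG.setB2a (dom Dl) (w.side .W) (farSW w), ΩG.plusMassD θ hr .W ω
  set MW := ∑ ω ∈ ΩG.setB2a (dom Dl) (w.side .W) (farSW w), ΩG.minusMassD θ hr .W ω
  have hN := hge .N; have hE := hge .E; have hS := hge .S; have hW := hge .W
  have cN := cos_le_re_rot_pairDir hθ .N
  have cE := cos_le_re_rot_pairDir hθ .E
  have cS := cos_le_re_rot_pairDir hθ .S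
  have cW := cos_le_re_rot_pairDir hθ .W
  have key : (ρ * (pairDir θ .N * ((PN - MN : ℝ) : ℂ) + pairDir θ .E * ((PE - ME : ℝ) : ℂ) +
      pairDir θ .S * ((PS - MS : ℝ) : ℂ) + pairDir θ .W * ((PW - MW : ℝ) : ℂ))).re =
      (ρ * pairDir θ .N).re * (PN - MN) + (ρ * pairDir θ .E).re * (PE - ME) + (ρ * pairDir θ .S).re * (PS - MS) +
        (ρ * pairDir θ .W).re * (PW - MW) := by
    simp only [mul_add, Complex.add_re, ← mul_assoc, Complex.re_mul_ofReal]
  have hpos : 0 < (ρ * (pairDir θ .N * ((PN - MN : ℝ) : ℂ) + pairDir θ .E * ((PE - ME : ℝ) : ℂ) +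
      pairDir θ .S * ((PS - MS : ℝ) : ℂ) + pairDir θ .W * ((PW - MW : ℝ) : ℂ))).re := by
    rw [key]
    obtain ⟨z, hz⟩ := hgt
    rcases z with _ | _ | _ | _
    · change MW < PW at hz; nlinarith
    · change ME < PE at hz; nlinarith
    · change MS < PS at hz; nlinarith
    · change MN < PN at hz; nlinarith
  have h0' : pairDir θ .N * ((PN - MN : ℝ) : ℂ) + pairDir θ .E * ((PE - ME : ℝ) : ℂ) +
      pairDir θ .S * ((PS - MS : ℝ) : ℂ) + pairDir θ .W * ((PW - MW : ℝ) : ℂ) = 0 := by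
    have := h0; push_cast at this ⊢; exact this
  rw [h0', mul_zero, Complex.zero_re] at hpos
  exact lt_irrefl _ hpos


/-- ★★★ **THE ZERO SET OF THE DEFECT AT THE DIAGONAL CELL** (`θ ∈ [π/3, 2π/3]`): `VF_D(w.side W, d) = 0` iff
`Σ_{z₃} pairDir(θ, z₃)·(P(z₃) − M(z₃)) = 0` — one complex (two real) linear condition(s) on the four signed pattern-mass differences.
[cite: GlazmanManolescu2019, Lemma 2.1 (statement, "in the form given in [Gl]")] [cite: Glazman2015WeightedSAW, Lemma 3.1 (proof, pp. 6–7)]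
[cite: Hopf1935, Nr. 2 (Umlaufsatz, p. 53) and Nr. 4 eq. (22) (curves with corners, pp. 60–61)] -/
theorem vertexFunctional_printed_farSW_eq_zero_iff_pairing {θ : ℝ} (hθ : θ ∈ Set.Icc (π / 3) (2 * π / 3))
    (Dl : List Face) (w : Face) (hf : farSW w ∈ Dl) (hh : holeFaceW w ∉ dom Dl)
    (hr : RootedFace (dom Dl) (w.side .W) (farSW w)) :
    vertexFunctional (printedWeights θ) tFiveEighths (ybCoeff θ) Dl (w.side .W) (farSW w) = 0 ↔
      pairDir θ .N * ((∑ ω ∈ ΩG.setB2a (dom Dl) (w.side .W) (farSW w), ΩG.plusMassD θ hr .N ω - ∑ ω ∈ ΩG.setB2a (dom Dl) (w.side .W) (farSW w), ΩG.minusMassD θ hr .N ω : ℝ) : ℂ) +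
        pairDir θ .E * ((∑ ω ∈ ΩG.setB2a (dom Dl) (w.side .W) (farSW w), ΩG.plusMassD θ hr .E ω - ∑ ω ∈ ΩG.setB2a (dom Dl) (w.side .W) (farSW w), ΩG.minusMassD θ hr .E ω : ℝ) : ℂ) +
        pairDir θ .S * ((∑ ω ∈ ΩG.setB2a (dom Dl) (w.side .W) (farSW w), ΩG.plusMassD θ hr .S ω - ∑ ω ∈ ΩG.setB2a (dom Dl) (w.side .W) (farSW w), ΩG.minusMassD θ hr .S ω : ℝ) : ℂ) +
        pairDir θ .W * ((∑ ω ∈ ΩG.setB2a (dom Dl) (w.side .W) (farSW w), ΩG.plusMassD θ hr .W ω - ∑ ω ∈ ΩG.setB2a (dom Dl) (w.side .W) (farSW w), ΩG.minusMassD θ hr .W ω : ℝ) : ℂ) = 0 := by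
  have hv : (weightV θ : ℂ) ≠ 0 := by
    have hθ0 : θ ∈ Set.Ioo 0 π := ⟨by linarith [hθ.1, Real.pi_pos], by linarith [hθ.2, Real.pi_pos]⟩
    exact_mod_cast (weightV_pos_of_mem_Ioo hθ0).ne'
  rw [vertexFunctional_printed_farSW_pairing hθ Dl w hf hh hr]
  constructor
  · intro h0
    rcases mul_eq_zero.1 h0 with h1 | h1
    · exact absurd h1 (mul_ne_zero Complex.I_ne_zero hv)
    · exact h1
  · intro h0
    rw [h0, mul_zero]

end Literature.Barriers.CriticalPhenomena.PlaquetteWalk
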